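import Summits.KontsevichZagierPeriods.KontsevichZagierPeriods.Theorems.HurwitzMicroSectorsNormalFormPrincipleDilogExistsBoxAtoms

/-!
# `NormalFormPrinciple` (stmt-KontsevichZagierPeriods-3869), line `SketchIdeator1` —
# leaf `stub_boxRigidity`, dilogarithm layer: the upper triangle and the rectangle (rule 2)

Pure proof file (registered sub-goal `upper_and_rect` of the layer `Dilog`, lead seat c9;
`--supports` the crux). In the scissors proof of Euler's reflection formula
`Li₂(z) + Li₂(1 − z) + log z · log(1 − z) = ζ(2)` inside the Kontsevich–Zagier calculus, the
`ζ(2)`-simplex `{0 < t₁ < t₀ < 1}` with integrand `f(t) = 1/(t₀(1 − t₁))` is cut at height `z`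
into a lower triangle, an UPPER triangle `{z < t₁ < t₀ < 1}` and a RECTANGLE
`{0 < t₁ < z < t₀ < 1} = (z,1) × (0,z)`. This file identifies the last two pieces with standard
pieces, each by ONE affine change of variables (rule (2) of the calculus: a single element of
`KZ.changeOfVariablesRel`):

* the point reflection `ρ(t) = (1 − t₁, 1 − t₀)` — a `ℚ`-polynomial involution of `ℝ²` with
  `|det Dρ| = 1` and `f ∘ ρ = f` — carries the lower triangle `{0 < t₁ < t₀ < 1 − z}` onto the
  upper triangle `{z < t₁ < t₀ < 1}` (`uar_exists_reflection`, `uar_upper_mem_relations`);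
* for real algebraic `a > 1` and `z = 1/a`, the affine chart `Φ(x) = (z + (1 − z)x₀, z − z x₁)`
  of the open unit box `(0,1)²` (`|det DΦ| = z(1 − z)`) carries the log-product box
  `[(0,1)², 1/((1/(a − 1) + x₀)((a − 1) + x₁))]` onto the rectangle
  `[{0 < t₁ < z < t₀ < 1}, f]` (`uar_exists_rectChart`, `uar_rect_pullback`,
  `uar_rect_mem_relations`).

Pattern of `AlgLevelTwo.lt2_exists_squaresChart` / `AlgLevelTwo.levelTwo_squares` (seat c8): the
charts and their (constant) derivatives are written out inside the proofs, so that the file is a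
pure proof file.

References: M. Kontsevich, D. Zagier, *Periods* (2001), §1.1–1.2, rule (2). No definitions are
introduced.
-/

noncomputable section

open MeasureTheory Set
open Literature.NumberTheory.Transcendental Literature.NumberTheory.Transcendental.KZ
open Literature.ModelTheory.ExponentialFields (IsSemialgebraic)

namespace Summit.KontsevichZagierPeriods.HurwitzMicroSectors.NormalFormPrinciple.PiBox.Dilog

/-! ## The point reflection `ρ(t) = (1 − t₁, 1 − t₀)` -/

/-- **The point reflection `ρ(t) = (1 − t₁, 1 − t₀)` of `ℝ²`.** A `ℚ`-polynomial map (hence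
`ℚ`-semialgebraic on every `ℚ`-semialgebraic set), differentiable with the constant derivative
`(v₀, v₁) ↦ (−v₁, −v₀)` of determinant `−1`, an involution (hence injective), mapping the lower
triangle `{0 < t₁ < t₀ < 1 − z}` ONTO the upper triangle `{z < t₁ < t₀ < 1}` (it is its own
inverse). [folklore] -/
theorem uar_exists_reflection (z : ℝ) :
    ∃ (ρ : (Fin 2 → ℝ) → (Fin 2 → ℝ)) (ρ' : (Fin 2 → ℝ) → (Fin 2 → ℝ) →L[ℝ] (Fin 2 → ℝ)),
      (∀ t, ρ t 0 = 1 - t 1) ∧ (∀ t, ρ t 1 = 1 - t 0) ∧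
      (∀ σ : Set (Fin 2 → ℝ), IsSemialgebraic ℚ σ → IsSemialgebraicMapOn ℚ σ ρ) ∧
      (∀ t, HasFDerivAt ρ (ρ' t) t) ∧
      Function.Injective ρ ∧
      ρ '' {t : Fin 2 → ℝ | 0 < t 1 ∧ t 1 < t 0 ∧ t 0 < 1 - z} =
        {t : Fin 2 → ℝ | z < t 1 ∧ t 1 < t 0 ∧ t 0 < 1} ∧
      (∀ t, |(ρ' t).det| = 1) := by
  set ρ : (Fin 2 → ℝ) → (Fin 2 → ℝ) := fun t => ![1 - t 1, 1 - t 0]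
  set ρ' : (Fin 2 → ℝ) → (Fin 2 → ℝ) →L[ℝ] (Fin 2 → ℝ) :=
    fun _ => LinearMap.toContinuousLinearMap (Matrix.toLin' !![(0:ℝ), -1; -1, 0])
  have hρ0 : ∀ t, ρ t 0 = 1 - t 1 := fun t => rfl
  have hρ1 : ∀ t, ρ t 1 = 1 - t 0 := fun t => rfl
  have hρ'0 : ∀ t v : Fin 2 → ℝ, ρ' t v 0 = -v 1 := by
    intro t v
    change Matrix.toLin' !![(0:ℝ), -1; -1, 0] v 0 = _
    rw [Matrix.toLin'_apply]
    simp [Matrix.mulVec, dotProduct, Fin.sum_univ_two]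
  have hρ'1 : ∀ t v : Fin 2 → ℝ, ρ' t v 1 = -v 0 := by
    intro t v
    change Matrix.toLin' !![(0:ℝ), -1; -1, 0] v 1 = _
    rw [Matrix.toLin'_apply]
    simp [Matrix.mulVec, dotProduct, Fin.sum_univ_two]
  have hdet : ∀ t, (ρ' t).det = -1 := by
    intro t
    change LinearMap.det (Matrix.toLin' !![(0:ℝ), -1; -1, 0]) = _
    rw [LinearMap.det_toLin', Matrix.det_fin_two_of]
    norm_num
  have hderiv : ∀ t, HasFDerivAt ρ (ρ' t) t := by
    intro t
    have h0 : HasFDerivAt (fun y : Fin 2 → ℝ => y 0)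
        (ContinuousLinearMap.proj (R := ℝ) (φ := fun _ : Fin 2 => ℝ) 0) t := hasFDerivAt_apply 0 t
    have h1 : HasFDerivAt (fun y : Fin 2 → ℝ => y 1)
        (ContinuousLinearMap.proj (R := ℝ) (φ := fun _ : Fin 2 => ℝ) 1) t := hasFDerivAt_apply 1 t
    rw [hasFDerivAt_pi']
    refine Fin.forall_fin_two.mpr ⟨?_, ?_⟩
    · have hf : (fun y : Fin 2 → ℝ => ρ y 0) = fun y => 1 - y 1 := funext fun y => hρ0 y
      rw [hf]
      refine ((hasFDerivAt_const (1:ℝ) t).sub h1).congr_fderiv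
        (ContinuousLinearMap.ext fun v => ?_)
      simp [hρ'0]
    · have hf : (fun y : Fin 2 → ℝ => ρ y 1) = fun y => 1 - y 0 := funext fun y => hρ1 y
      rw [hf]
      refine ((hasFDerivAt_const (1:ℝ) t).sub h0).congr_fderiv
        (ContinuousLinearMap.ext fun v => ?_)
      simp [hρ'1]
  -- `ρ` is an involution
  have hinv : ∀ t, ρ (ρ t) = t := fun t =>
    funext (Fin.forall_fin_two.mpr
      ⟨by rw [hρ0, hρ1, sub_sub_cancel], by rw [hρ1, hρ0, sub_sub_cancel]⟩)
  refine ⟨ρ, ρ', hρ0, hρ1, fun σ hσ => ?_, hderiv, fun x y hxy => ?_, ?_,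
    fun t => by rw [hdet t, abs_neg, abs_one]⟩
  · -- a `ℚ`-polynomial map is `ℚ`-semialgebraic
    convert isSemialgebraicMapOn_aeval hσ
      ![1 - MvPolynomial.X 1, (1 - MvPolynomial.X 0 : MvPolynomial (Fin 2) ℚ)] using 2 with t
    funext i
    fin_cases i
    · simp [hρ0]
    · simp [hρ1]
  · -- injective: apply the involution `ρ` to both sides
    have h := congrArg ρ hxy
    rwa [hinv, hinv] at h
  · -- the lower triangle is mapped onto the upper triangle
    ext t
    constructor
    · rintro ⟨x, ⟨h1, h2, h3⟩, rfl⟩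
      refine ⟨?_, ?_, ?_⟩ <;> simp only [hρ0, hρ1] <;> linarith
    · rintro ⟨h1, h2, h3⟩
      refine ⟨ρ t, ⟨?_, ?_, ?_⟩, hinv t⟩ <;> simp only [hρ0, hρ1] <;> linarith

/-- **The upper triangle (rule 2).** For any real `z` and any two representations `B`, `A` with
domains the upper triangle `{z < t₁ < t₀ < 1}` and the lower triangle `{0 < t₁ < t₀ < 1 − z}`
and the common integrand `1/(t₀(1 − t₁))`, `[B] − [A] ∈ KZ.relations`: the point reflection
`ρ(t) = (1 − t₁, 1 − t₀)` (`uar_exists_reflection`) is ONE change-of-variables move from `A` onto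
`B`, the pull-back identity being `1/((1 − t₁)(1 − (1 − t₀))) · 1 = 1/(t₀(1 − t₁))`; the move
gives `[A] − [B]`, and `relations` is a subgroup. [cite: KontsevichZagier2001, §1.2 rule (2)] -/
theorem uar_upper_mem_relations (z : ℝ) (B A : IntegralRep 2)
    (hBd : B.domain = {t | z < t 1 ∧ t 1 < t 0 ∧ t 0 < 1})
    (hBi : EqOn B.integrand (fun t => 1 / (t 0 * (1 - t 1))) B.domain)
    (hAd : A.domain = {t | 0 < t 1 ∧ t 1 < t 0 ∧ t 0 < 1 - z})
    (hAi : EqOn A.integrand (fun t => 1 / (t 0 * (1 - t 1))) A.domain) :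
    of B - of A ∈ relations := by
  obtain ⟨ρ, ρ', hρ0, hρ1, hsa, hderiv, hinj, himage, hdet⟩ := uar_exists_reflection z
  have himage' : B.domain = ρ '' A.domain := by rw [hAd, himage, hBd]
  have h : of A - of B ∈ relations := by
    refine changeOfVariablesRel_subset_relations
      ⟨2, A, B, ρ, ρ', hsa _ A.isSemialgebraic_domain, fun x _ => (hderiv x).hasFDerivWithinAt,
        hinj.injOn, himage', fun x hx => ?_, rfl⟩
    -- the pull-back identity on `A.domain`, Jacobian `|det Dρ| = 1` included
    have hρx : ρ x ∈ B.domain := himage' ▸ mem_image_of_mem _ hx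
    rw [hAi hx, hBi hρx, hdet x, mul_one]
    simp only [hρ0, hρ1, sub_sub_cancel]
    ring
  have h' := relations.neg_mem h
  rwa [neg_sub] at h'

/-! ## The affine chart of the box onto the rectangle `(z,1) × (0,z)` -/

/-- **The affine chart `Φ(x) = (z + (1 − z)x₀, z − z x₁)`** of the open unit box `(0,1)²` onto
the rectangle `{0 < t₁ < z < t₀ < 1}`, for real algebraic `z ∈ (0,1)`: its components are
`ℚ`-semialgebraic functions on the box (the constants `z`, `1 − z` are real algebraic), it is
differentiable with the constant derivative `diag(1 − z, −z)` of absolute determinant `z(1 − z)`,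
injective, and ONTO the rectangle (inverse `x₀ = (t₀ − z)/(1 − z)`, `x₁ = (z − t₁)/z`).
[folklore] -/
theorem uar_exists_rectChart {z : ℝ} (hz : IsAlgebraic ℚ z) (hz0 : 0 < z) (hz1 : z < 1) :
    ∃ (Φ : (Fin 2 → ℝ) → (Fin 2 → ℝ)) (Φ' : (Fin 2 → ℝ) → (Fin 2 → ℝ) →L[ℝ] (Fin 2 → ℝ)),
      (∀ x, Φ x 0 = z + (1 - z) * x 0) ∧ (∀ x, Φ x 1 = z - z * x 1) ∧
      IsSemialgebraicMapOn ℚ {x : Fin 2 → ℝ | ∀ i, x i ∈ Set.Ioo (0:ℝ) 1} Φ ∧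
      (∀ x, HasFDerivAt Φ (Φ' x) x) ∧
      Set.InjOn Φ {x : Fin 2 → ℝ | ∀ i, x i ∈ Set.Ioo (0:ℝ) 1} ∧
      Φ '' {x : Fin 2 → ℝ | ∀ i, x i ∈ Set.Ioo (0:ℝ) 1} =
        {t : Fin 2 → ℝ | 0 < t 1 ∧ t 1 < z ∧ z < t 0 ∧ t 0 < 1} ∧
      (∀ x, |(Φ' x).det| = z * (1 - z)) := by
  have h1z : 0 < 1 - z := sub_pos.2 hz1
  set Φ : (Fin 2 → ℝ) → (Fin 2 → ℝ) := fun x => ![z + (1 - z) * x 0, z - z * x 1]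
  set Φ' : (Fin 2 → ℝ) → (Fin 2 → ℝ) →L[ℝ] (Fin 2 → ℝ) :=
    fun _ => LinearMap.toContinuousLinearMap (Matrix.toLin' !![1 - z, 0; 0, -z])
  have hΦ0 : ∀ x, Φ x 0 = z + (1 - z) * x 0 := fun x => rfl
  have hΦ1 : ∀ x, Φ x 1 = z - z * x 1 := fun x => rfl
  have hΦ'0 : ∀ x v : Fin 2 → ℝ, Φ' x v 0 = (1 - z) * v 0 := by
    intro x v
    change Matrix.toLin' !![1 - z, 0; 0, -z] v 0 = _
    rw [Matrix.toLin'_apply]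
    simp [Matrix.mulVec, dotProduct, Fin.sum_univ_two]
  have hΦ'1 : ∀ x v : Fin 2 → ℝ, Φ' x v 1 = -(z * v 1) := by
    intro x v
    change Matrix.toLin' !![1 - z, 0; 0, -z] v 1 = _
    rw [Matrix.toLin'_apply]
    simp [Matrix.mulVec, dotProduct, Fin.sum_univ_two]
  have hdet : ∀ x, (Φ' x).det = -(z * (1 - z)) := by
    intro x
    change LinearMap.det (Matrix.toLin' !![1 - z, 0; 0, -z]) = _
    rw [LinearMap.det_toLin', Matrix.det_fin_two_of]
    ring
  have hderiv : ∀ x, HasFDerivAt Φ (Φ' x) x := by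
    intro x
    have h0 : HasFDerivAt (fun y : Fin 2 → ℝ => y 0)
        (ContinuousLinearMap.proj (R := ℝ) (φ := fun _ : Fin 2 => ℝ) 0) x := hasFDerivAt_apply 0 x
    have h1 : HasFDerivAt (fun y : Fin 2 → ℝ => y 1)
        (ContinuousLinearMap.proj (R := ℝ) (φ := fun _ : Fin 2 => ℝ) 1) x := hasFDerivAt_apply 1 x
    rw [hasFDerivAt_pi']
    refine Fin.forall_fin_two.mpr ⟨?_, ?_⟩
    · have hf : (fun y : Fin 2 → ℝ => Φ y 0) = fun y => z + (1 - z) * y 0 :=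
        funext fun y => hΦ0 y
      rw [hf]
      refine ((hasFDerivAt_const z x).add (h0.const_mul (1 - z))).congr_fderiv
        (ContinuousLinearMap.ext fun v => ?_)
      simp [hΦ'0]
    · have hf : (fun y : Fin 2 → ℝ => Φ y 1) = fun y => z - z * y 1 :=
        funext fun y => hΦ1 y
      rw [hf]
      refine ((hasFDerivAt_const z x).sub (h1.const_mul z)).congr_fderiv
        (ContinuousLinearMap.ext fun v => ?_)
      simp [hΦ'1]
  have hB := isSemialgebraic_box 2
  refine ⟨Φ, Φ', hΦ0, hΦ1, ?_, hderiv, fun x _ y _ hxy => ?_, ?_, fun x => ?_⟩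
  · -- affine with the real algebraic constants `z`, `1 − z`: componentwise `ℚ`-semialgebraic
    refine IsSemialgebraicMapOn.of_forall hB (Fin.forall_fin_two.mpr ⟨?_, ?_⟩)
    · exact (IsSemialgebraicFunOn.add_holds (isSemialgebraicFunOn_const_of_isAlgebraic hB hz)
        (IsSemialgebraicFunOn.mul_holds
          (isSemialgebraicFunOn_const_of_isAlgebraic hB (isAlgebraic_one.sub hz))
          (isSemialgebraicFunOn_apply hB 0))).congr fun _ _ => rfl
    · exact (IsSemialgebraicFunOn.sub_holds (isSemialgebraicFunOn_const_of_isAlgebraic hB hz)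
        (IsSemialgebraicFunOn.mul_holds (isSemialgebraicFunOn_const_of_isAlgebraic hB hz)
          (isSemialgebraicFunOn_apply hB 1))).congr fun _ _ => rfl
  · -- injective (in fact on all of `ℝ²`, as `z ≠ 0` and `1 − z ≠ 0`)
    have e0 : z + (1 - z) * x 0 = z + (1 - z) * y 0 := by rw [← hΦ0, ← hΦ0, hxy]
    have e1 : z - z * x 1 = z - z * y 1 := by rw [← hΦ1, ← hΦ1, hxy]
    have h0 : x 0 = y 0 := mul_left_cancel₀ h1z.ne' (add_left_cancel e0)
    have h1 : x 1 = y 1 := mul_left_cancel₀ hz0.ne' (sub_right_inj.mp e1)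
    exact funext (Fin.forall_fin_two.mpr ⟨h0, h1⟩)
  · -- onto the rectangle `(z,1) × (0,z)`
    ext t
    constructor
    · rintro ⟨x, hx, rfl⟩
      have p0 : 0 < (1 - z) * x 0 := mul_pos h1z (hx 0).1
      have q0 : (1 - z) * x 0 < 1 - z := mul_lt_of_lt_one_right h1z (hx 0).2
      have p1 : 0 < z * x 1 := mul_pos hz0 (hx 1).1
      have q1 : z * x 1 < z := mul_lt_of_lt_one_right hz0 (hx 1).2
      refine ⟨?_, ?_, ?_, ?_⟩ <;> simp only [hΦ0, hΦ1] <;> linarith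
    · rintro ⟨h1, h2, h3, h4⟩
      refine ⟨![(t 0 - z) / (1 - z), (z - t 1) / z], Fin.forall_fin_two.mpr ⟨?_, ?_⟩,
        funext (Fin.forall_fin_two.mpr ⟨?_, ?_⟩)⟩
      · change (t 0 - z) / (1 - z) ∈ Set.Ioo (0:ℝ) 1
        exact ⟨div_pos (by linarith) h1z, (div_lt_one h1z).2 (by linarith)⟩
      · change (z - t 1) / z ∈ Set.Ioo (0:ℝ) 1
        exact ⟨div_pos (by linarith) hz0, (div_lt_one hz0).2 (by linarith)⟩
      · rw [hΦ0]
        change z + (1 - z) * ((t 0 - z) / (1 - z)) = t 0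
        rw [mul_div_cancel₀ _ h1z.ne']
        ring
      · rw [hΦ1]
        change z - z * ((z - t 1) / z) = t 1
        rw [mul_div_cancel₀ _ hz0.ne']
        ring
  · -- the Jacobian
    rw [hdet x, abs_neg, abs_of_pos (mul_pos hz0 h1z)]

/-- **The pull-back identity** of the affine chart onto the rectangle (Jacobian `a⁻¹(1 − a⁻¹)`
included), for `a > 1`, `z = a⁻¹` and all real `x₀, x₁`:
`1/((1/(a − 1) + x₀)((a − 1) + x₁)) = 1/((z + (1 − z)x₀)(1 − (z − z x₁))) · z(1 − z)`, because
`z + (1 − z)x₀ = z(a − 1)(1/(a − 1) + x₀)`, `1 − z + z x₁ = z((a − 1) + x₁)` and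
`1/(cL) · c = 1/L` for `c = z²(a − 1) ≠ 0` (no hypothesis on `L`). [folklore] -/
theorem uar_rect_pullback {a x₀ x₁ : ℝ} (ha1 : 1 < a) :
    1 / ((1 / (a - 1) + x₀) * ((a - 1) + x₁)) =
      1 / ((a⁻¹ + (1 - a⁻¹) * x₀) * (1 - (a⁻¹ - a⁻¹ * x₁))) * (a⁻¹ * (1 - a⁻¹)) := by
  have ha0 : a ≠ 0 := (one_pos.trans ha1).ne'
  have ha' : a - 1 ≠ 0 := (sub_pos.2 ha1).ne'
  -- the three factors of the right-hand side, in terms of the left-hand denominator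
  have e₁ : a⁻¹ + (1 - a⁻¹) * x₀ = a⁻¹ * (a - 1) * (1 / (a - 1) + x₀) := by
    calc a⁻¹ + (1 - a⁻¹) * x₀ = a⁻¹ * 1 + (1 - a⁻¹) * x₀ := by rw [mul_one]
      _ = a⁻¹ * ((a - 1) * (1 / (a - 1))) + (a⁻¹ * a - a⁻¹) * x₀ := by
          rw [mul_one_div_cancel ha', inv_mul_cancel₀ ha0]
      _ = a⁻¹ * (a - 1) * (1 / (a - 1) + x₀) := by ring
  have e₂ : 1 - (a⁻¹ - a⁻¹ * x₁) = a⁻¹ * ((a - 1) + x₁) := by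
    calc 1 - (a⁻¹ - a⁻¹ * x₁) = a⁻¹ * a - (a⁻¹ - a⁻¹ * x₁) := by rw [inv_mul_cancel₀ ha0]
      _ = a⁻¹ * ((a - 1) + x₁) := by ring
  have e₃ : a⁻¹ * (1 - a⁻¹) = a⁻¹ * (a - 1) * a⁻¹ := by
    calc a⁻¹ * (1 - a⁻¹) = a⁻¹ * (a⁻¹ * a - a⁻¹) := by rw [inv_mul_cancel₀ ha0]
      _ = a⁻¹ * (a - 1) * a⁻¹ := by ring
  -- `1/L = 1/(c·L) · c` with `c = a⁻¹(a − 1)a⁻¹ ≠ 0` and `L` the left-hand denominator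
  have hc : a⁻¹ * (a - 1) * a⁻¹ ≠ 0 :=
    mul_ne_zero (mul_ne_zero (inv_ne_zero ha0) ha') (inv_ne_zero ha0)
  rw [e₁, e₂, e₃, show a⁻¹ * (a - 1) * (1 / (a - 1) + x₀) * (a⁻¹ * ((a - 1) + x₁)) =
    (a⁻¹ * (a - 1) * a⁻¹) * ((1 / (a - 1) + x₀) * ((a - 1) + x₁)) by ring,
    div_mul_eq_mul_div, one_mul, div_mul_cancel_left₀ hc, one_div]

/-- **The rectangle (rule 2).** For real algebraic `a > 1`, `a z = 1`, and any two
representations `C`, `P` with domains the rectangle `{0 < t₁ < z < t₀ < 1}` and the open unit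
box, and integrands `1/(t₀(1 − t₁))` and `1/((1/(a − 1) + x₀)((a − 1) + x₁))` respectively,
`[P] − [C] ∈ KZ.relations`: the affine chart `Φ(x) = (z + (1 − z)x₀, z − z x₁)`
(`uar_exists_rectChart`, `ℚ`-semialgebraic because `z = a⁻¹` is real algebraic) is ONE
change-of-variables move from `P` onto `C`, with the pull-back identity `uar_rect_pullback`.
[cite: KontsevichZagier2001, §1.2 rule (2)] -/
theorem uar_rect_mem_relations {a z : ℝ} (ha : IsAlgebraic ℚ a) (ha1 : 1 < a) (haz : a * z = 1)
    (C P : IntegralRep 2)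
    (hCd : C.domain = {t | 0 < t 1 ∧ t 1 < z ∧ z < t 0 ∧ t 0 < 1})
    (hCi : EqOn C.integrand (fun t => 1 / (t 0 * (1 - t 1))) C.domain)
    (hPd : P.domain = {x | ∀ i, x i ∈ Set.Ioo (0:ℝ) 1})
    (hPi : EqOn P.integrand (fun x => 1 / ((1 / (a - 1) + x 0) * ((a - 1) + x 1))) P.domain) :
    of P - of C ∈ relations := by
  obtain rfl : z = a⁻¹ := eq_inv_of_mul_eq_one_right haz
  have hz0 : 0 < a⁻¹ := inv_pos.2 (one_pos.trans ha1)
  have hz1 : a⁻¹ < 1 := inv_lt_one_of_one_lt₀ ha1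
  obtain ⟨Φ, Φ', hΦ0, hΦ1, hsa, hderiv, hinj, himage, hdet⟩ := uar_exists_rectChart ha.inv hz0 hz1
  have himage' : C.domain = Φ '' P.domain := by rw [hPd, himage, hCd]
  have hsa' : IsSemialgebraicMapOn ℚ P.domain Φ := by rw [hPd]; exact hsa
  have hinj' : InjOn Φ P.domain := by rw [hPd]; exact hinj
  refine changeOfVariablesRel_subset_relations
    ⟨2, P, C, Φ, Φ', hsa', fun x _ => (hderiv x).hasFDerivWithinAt, hinj', himage',
      fun x hx => ?_, rfl⟩
  -- the pull-back identity on `P.domain`, Jacobian `|det DΦ| = z(1 − z)` included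
  have hΦx : Φ x ∈ C.domain := himage' ▸ mem_image_of_mem _ hx
  rw [hPi hx, hCi hΦx, hdet x]
  simp only [hΦ0, hΦ1]
  exact uar_rect_pullback ha1

/-! ## The registered sub-goal -/

/-- **Stub S4 (`upper_and_rect`; registered sub-goal of stmt-KontsevichZagierPeriods-3869, line
`SketchIdeator1`, layer `Dilog`).** In the dissection of the `ζ(2)`-simplex `{0 < t₁ < t₀ < 1}`
(integrand `1/(t₀(1 − t₁))`) at height `z`: (1) the point reflection `t ↦ (1 − t₁, 1 − t₀)`
(rule 2, `|det| = 1`) identifies the upper triangle `[{z < t₁ < t₀ < 1}, 1/(t₀(1 − t₁))]` with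
the lower triangle `[{0 < t₁ < t₀ < 1 − z}, 1/(t₀(1 − t₁))]`; (2) for real algebraic `a > 1` with
`a z = 1`, the affine chart `x ↦ (z + (1 − z)x₀, z − z x₁)` of the open unit box (rule 2,
`|det| = z(1 − z)`) identifies the log-product box `[(0,1)², 1/((1/(a − 1) + x₀)((a − 1) + x₁))]`
with the rectangle `[{0 < t₁ < z < t₀ < 1}, 1/(t₀(1 − t₁))]`. Each is a single element of
`KZ.changeOfVariablesRel`. [cite: KontsevichZagier2001, §1.2 rule (2)] -/
theorem upper_and_rect :
    (∀ (z : ℝ), 0 < z → z < 1 → ∀ (B A : IntegralRep 2),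
      B.domain = {t | z < t 1 ∧ t 1 < t 0 ∧ t 0 < 1} →
      EqOn B.integrand (fun t => 1 / (t 0 * (1 - t 1))) B.domain →
      A.domain = {t | 0 < t 1 ∧ t 1 < t 0 ∧ t 0 < 1 - z} →
      EqOn A.integrand (fun t => 1 / (t 0 * (1 - t 1))) A.domain →
      of B - of A ∈ relations) ∧
    (∀ (a z : ℝ), IsAlgebraic ℚ a → 1 < a → a * z = 1 → ∀ (C P : IntegralRep 2),
      C.domain = {t | 0 < t 1 ∧ t 1 < z ∧ z < t 0 ∧ t 0 < 1} →
      EqOn C.integrand (fun t => 1 / (t 0 * (1 - t 1))) C.domain →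
      P.domain = {x | ∀ i, x i ∈ Set.Ioo (0:ℝ) 1} →
      EqOn P.integrand (fun x => 1 / ((1 / (a - 1) + x 0) * ((a - 1) + x 1))) P.domain →
      of P - of C ∈ relations) := by
  exact ⟨fun z _ _ B A hBd hBi hAd hAi => uar_upper_mem_relations z B A hBd hBi hAd hAi,
    fun _ _ ha ha1 haz C P hCd hCi hPd hPi => uar_rect_mem_relations ha ha1 haz C P hCd hCi hPd hPi⟩

end Summit.KontsevichZagierPeriods.HurwitzMicroSectors.NormalFormPrinciple.PiBox.Dilog
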